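import Summits.BirchSwinnertonDyer.BirchSwinnertonDyer.Theorems.GenusKolyvaginAtTwoPowDvdShaCardAtTwoRTLocalKernelSaturated
import Summits.BirchSwinnertonDyer.BirchSwinnertonDyer.Theorems.GenusKolyvaginAtTwoPowDvdShaCardAtTwoRTRelaxedShaGenusBudget
import Summits.BirchSwinnertonDyer.BirchSwinnertonDyer.Theorems.GenusKolyvaginAtTwoPowDvdShaCardAtTwoRTGenusParity
import Summits.BirchSwinnertonDyer.BirchSwinnertonDyer.Theorems.GenusKolyvaginAtTwoGenusPrimitiveSupplyAtTwoPrimeHeegnerTwinDichotomy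
import Literature.NumberTheory.EllipticCurves.QuadraticTwistKroneckerLFunctionProofs
import HarnessLib

/-!
# Route `GenusKolyvaginAtTwo`, LINE 18 / LINE 19 (L_T stmt-BirchSwinnertonDyer-23242, L⁺_T stmt-23379) — AT LEVEL `2` THE
# `d_K`-RELAXED GROUP IS `Ш` RELAXED COMPLETELY AT THE PRIMES OF `d_K`: `Ш^S(E)[2] ⊆ res⁻¹Ш(E_K)` (4/4)

Seat `bsd-line-gk2-p3` g20 (cell `bsd-f1-sign2`), `--supports stmt-BirchSwinnertonDyer-23242` (helper; closes nothing).
THEOREMS ONLY (no definition, no named fact, no `sorry`); BSD is not proved by any of this.  Sequel of `…RTLocalKernelSaturated`.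

WHAT.  For `E/ℚ` elliptic and a quadratic field `K` with odd `d_K` such that `E` has good reduction at every prime of `d_K` and at
every non-split `p ∤ d_K` (the Heegner field of LINE 18/19): a class `c ∈ H¹(ℚ, E)` with `2c = 0` which is locally trivial at
every finite place OFF `d_K` and at `ℝ` restricts into `Ш(E_K/K)` — **`resBaseChange_mem_sha_of_two_nsmul_eq_zero`**; the local
binder form **`mem_localRestrictionKer_of_two_nsmul_eq_zero_of_dvd_discr`** (`[K_w : ℚ_p] = 2`, `v_p(d_K) = 1`, `√d_K ∈ K`
discharged for the quadratic field).  At the primes of `d_K` NOTHING is asked: there the local kernel is saturated (3/4); off `d_K`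
the `K_w`- and `ℚ_p`-conditions agree (g18 `localRestrictionKer_adicCompletion_eq_of_not_dvd_discr_of_imp`); at the infinite places
the condition climbs the tower `ℝ → K_w` (`localRestrictionKer_le_of_tower`).  With g18's converse inclusion this says: on
`H¹(ℚ, E)[2]` the relaxed group `res⁻¹Ш(E_K)` of the LINE 18 ladder count IS Kramer's genus group `Ш^S(E)` (`S` = primes of `d_K`),
whose size is governed by his §4 (13) — the global half of the stub-J audit's §2 (memo `Lines/plus-descent-stubJ-audit.md`).  The
count of `Ш^S(E)[2]` itself (Greenberg–Wiles, `#Sel^S_2 = 2^B · #Sel_{S-strict,2}`) is not in this file.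

References: [Kramer1981] §2 Prop. 3, §4 (11)–(13) and the Remark after Cor. 2; [MilneADT2006] I §3, §6; [Matsuno2009] §3;
[NeukirchANT1999] II (8.5).
-/

set_option autoImplicit false
-- the Theorems namespace of this sub repeats the summit name by design (D-0017 nested layout)
set_option linter.dupNamespace false

noncomputable section

open scoped Classical

namespace Summit.BirchSwinnertonDyer.BirchSwinnertonDyer.Theorems.GenusExact.PlusDescent

open WeierstrassCurve Literature.NumberTheory.EllipticCurves Literature.NumberTheory.GaloisRepresentations
  Literature.Barriers.BirchSwinnertonDyer

universe u

/-! ## §5 The quadratic-field binders; `Ш^S(E)[2] ⊆ res⁻¹Ш(E_K)` -/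

section GenusRelaxed

open NumberField IsDedekindDomain Rat.HeightOneSpectrum

/-- **At a prime of `d_K` every `2`-torsion class of `H¹(ℚ, E)` satisfies the `K_w`-local condition** (`[K : ℚ] = 2`, `d_K` odd,
good reduction at `p ∣ d_K`, `w ∣ p`): the binders of `mem_localRestrictionKer_of_two_nsmul_eq_zero` discharged for the quadratic
field (`[K_w : ℚ_p] = 2` by `finrank_adicCompletion_primePlace_eq_two_of_dvd_discr`, `v_p(d_K) = 1` since `d_K` is squarefree,
`√d_K ∈ K`). [cite: Kramer1981, §2 Prop. 3] [cite: NeukirchANT1999, Ch. II Prop. (8.5)] -/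
theorem mem_localRestrictionKer_of_two_nsmul_eq_zero_of_dvd_discr (E : WeierstrassCurve ℚ) [E.IsElliptic]
    (K : Type) [Field K] [NumberField K] (h2 : Module.finrank ℚ K = 2) (hodd : Odd (NumberField.discr K))
    {p : ℕ} (hp : p.Prime) (hpd : (p : ℤ) ∣ NumberField.discr K)
    (hgood : E.HasGoodReductionAt (Matsuno2009.primePlace p))
    (w : HeightOneSpectrum (𝓞 K)) [w.asIdeal.LiesOver (Matsuno2009.primePlace p).asIdeal]
    {c : E.galH1} (hc : 2 • c = 0) : c ∈ E.localRestrictionKer (w.adicCompletion K) := by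
  haveI := Fact.mk hp
  have hp2 : p ≠ 2 := by
    rintro rfl
    obtain ⟨r, hr⟩ := hodd
    omega
  -- `√d_K ∈ K`
  obtain ⟨θ, hθ⟩ := GenusKolyTwin.exists_sq_eq_discr (K := K) h2
  have hθ' : θ ^ 2 = algebraMap ℚ K ((NumberField.discr K : ℤ) : ℚ) := by rw [hθ, map_intCast]
  -- `v_p(d_K) = 1` (`d_K` odd ⟹ squarefree)
  have hsq : Squarefree (NumberField.discr K).natAbs := squarefree_natAbs_discr_of_odd h2 hodd
  have hnot : ¬ ((p : ℕ) : ℤ) ^ 2 ∣ NumberField.discr K := by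
    intro h
    refine (Nat.squarefree_iff_prime_squarefree.mp hsq) p hp (Int.natCast_dvd.mp ?_)
    rw [Nat.cast_mul, ← sq]
    exact h
  have hdv : (Matsuno2009.primePlace p).valuation ℚ ((NumberField.discr K : ℤ) : ℚ) = WithZero.exp (-1 : ℤ) := by
    refine valuation_ringOfIntegers_intCast_eq_exp_neg_one (Matsuno2009.primePlace p) ?_ ?_
    · rw [Matsuno2009.primesEquiv_primePlace hp]; exact hpd
    · rw [Matsuno2009.primesEquiv_primePlace hp]; exact hnot
  exact mem_localRestrictionKer_of_two_nsmul_eq_zero E K (Matsuno2009.primePlace p) w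
    (finrank_adicCompletion_primePlace_eq_two_of_dvd_discr w h2 hp hp2 hpd)
    (two_not_mem_of_liesOver_primePlace K w hp2)
    (LocalDualityOrder.two_notMem_of_odd_prime_mem hp2 (Matsuno2009.natCast_mem_primePlace hp))
    hgood hdv θ hθ' hc

/-- **`Ш^S(E)[2] ⊆ res⁻¹Ш(E_K/K)`, `S` = primes of `d_K`.**  `E/ℚ` elliptic, `K` quadratic with odd `d_K`, `E` with good reduction at
the primes of `d_K` and at every non-split `p ∤ d_K` (Heegner field).  A class `c ∈ H¹(ℚ, E)` with `2c = 0`, locally trivial at every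
finite place OFF `d_K` and at `ℝ`, restricts into `Ш(E_K/K)` — no condition at the primes of `d_K` (saturation of the local kernels,
`mem_localRestrictionKer_of_two_nsmul_eq_zero`), `K_w = ℚ_p`-conditions off `d_K` (g18), tower at `∞`.  With g18's sandwich this is
«`res⁻¹Ш(E_K) ∩ H¹(ℚ,E)[2] ∩ (ℝ-condition) = Ш^S(E)[2]`» — Kramer's genus group for elements of order `2`.
[cite: Kramer1981, §4 (13) and Remark after Cor. 2] [cite: MilneADT2006, I §6] -/
theorem resBaseChange_mem_sha_of_two_nsmul_eq_zero (E : WeierstrassCurve ℚ) [E.IsElliptic]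
    (K : Type) [Field K] [NumberField K] (h2 : Module.finrank ℚ K = 2) (hodd : Odd (NumberField.discr K))
    (hgood : ∀ p : ℕ, p.Prime → ¬ (p : ℤ) ∣ NumberField.discr K →
      ((Ideal.span {(p : ℤ)}).primesOver (𝓞 K)).ncard ≠ 2 → E.HasGoodReductionAt (Matsuno2009.primePlace p))
    (hgoodram : ∀ p : ℕ, p.Prime → (p : ℤ) ∣ NumberField.discr K → E.HasGoodReductionAt (Matsuno2009.primePlace p))
    {c : E.galH1} (hc : 2 • c = 0)
    (hfin : ∀ p : ℕ, p.Prime → ¬ (p : ℤ) ∣ NumberField.discr K →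
      c ∈ E.localRestrictionKer ((Matsuno2009.primePlace p).adicCompletion ℚ))
    (hinf : ∀ u : InfinitePlace ℚ, c ∈ E.localRestrictionKer u.Completion) :
    resBaseChange E K c ∈ (E.baseChange K).sha := by
  rw [WeierstrassCurve.mem_sha_iff]
  refine ⟨fun w ↦ ?_, fun w ↦ ?_⟩
  · -- finite places: `w ∣ v ∣ p`
    let v : HeightOneSpectrum (𝓞 ℚ) := w.under (𝓞 ℚ)
    haveI hwv : w.asIdeal.LiesOver v.asIdeal := ⟨rfl⟩
    letI : Algebra (v.adicCompletion ℚ) (w.adicCompletion K) := (adicCompletionMap (K := ℚ) K v w).toAlgebra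
    haveI : IsScalarTower ℚ (v.adicCompletion ℚ) (w.adicCompletion K) :=
      IsScalarTower.of_algebraMap_eq fun x ↦ (adicCompletionMap_coe (K := ℚ) K v w x).symm
    set p : ℕ := (primesEquiv v : ℕ) with hpdef
    have hp : p.Prime := (primesEquiv v).2
    have hvp : Matsuno2009.primePlace p = v := primePlace_primesEquiv v
    haveI : w.asIdeal.LiesOver (Matsuno2009.primePlace p).asIdeal := by rw [hvp]; exact hwv
    have hcw : c ∈ E.localRestrictionKer (w.adicCompletion K) := by
      by_cases hpd : (p : ℤ) ∣ NumberField.discr K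
      · exact mem_localRestrictionKer_of_two_nsmul_eq_zero_of_dvd_discr E K h2 hodd hp hpd (hgoodram p hp hpd) w hc
      · rw [localRestrictionKer_adicCompletion_eq_of_not_dvd_discr_of_imp E h2 hodd hp hpd (hgood p hp hpd) w]
        exact hfin p hp hpd
    haveI : IsScalarTower ℚ K (w.adicCompletion K) := IsScalarTower.of_algebraMap_eq fun y ↦
      (IsScalarTower.algebraMap_apply ℚ K (w.adicCompletion K) y)
    exact (mem_localRestrictionKer_iff_resBaseChange_mem E (L := K) (E' := w.adicCompletion K) c).mp hcw
  · -- infinite places: `w ∣ u := w ∘ (ℚ → K)`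
    let u : InfinitePlace ℚ := w.comap (algebraMap ℚ K)
    haveI : w.1.LiesOver u.1 := ⟨rfl⟩
    haveI : IsScalarTower ℚ K w.Completion := IsScalarTower.of_algebraMap_eq fun x ↦ by
      apply NumberField.InfinitePlace.Completion.ext
      rw [NumberField.InfinitePlace.Completion.algebraMap_toCompletion,
        NumberField.InfinitePlace.Completion.algebraMap_toCompletion,
        UniformSpace.Completion.algebraMap_def, UniformSpace.Completion.algebraMap_def,
        IsScalarTower.algebraMap_apply ℚ K (WithAbs w.1)]
    letI : Algebra u.Completion w.Completion := NumberField.LiesOver.instAlgebraCompletion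
    haveI : IsScalarTower ℚ u.Completion w.Completion := NumberField.LiesOver.instIsScalarTowerCompletion
    exact (mem_localRestrictionKer_iff_resBaseChange_mem E c).mp
      (localRestrictionKer_le_of_tower E (E := u.Completion) (hinf u))

end GenusRelaxed

end Summit.BirchSwinnertonDyer.BirchSwinnertonDyer.Theorems.GenusExact.PlusDescent

end
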